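import Summits.HodgeConjecture.HodgeCM.PerL34.SeesawCharTypes_1

/-! PORT of `HodgeCM/PerL34/SeesawCharTypes.lean` (HodgeCMPerL run 82) — part 2: continuation of `Summits.HodgeConjecture.HodgeCM.PerL34.SeesawCharTypes_1` (split at a top-level declaration boundary by port_pkg.py; scope re-opened below; declarations unchanged). -/

-- port_pkg: scope re-opened for this part (file-level context, then the namespace/section stack open at the cut)
set_option autoImplicit false
noncomputable section
open Topology Set Function
namespace NumberField
namespace SeesawTorus
section InfinityType
variable {L : Type} [Field L] [NumberField L] [IsCMField L]
local notation "L⁺" => maximalRealSubfield L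
/-- Two automorphic characters have the same infinity type iff they agree on the image of `U(W_j)(L₀ ⊗ ℝ)`. -/
theorem infinityType_eq_infinityType_iff (χ χ' : PontryaginDual (relNormOneIdeles L⁺ L ⧸ relNormOneRat L⁺ L)) :
    infinityType χ = infinityType χ' ↔
      ∀ t : unitaryLineArchTorus L, χ (unitaryLineArchToQuot L t) = χ' (unitaryLineArchToQuot L t) := by
  constructor
  · intro h t
    apply Subtype.val_injective
    rw [apply_archToQuot, apply_archToQuot, h]
  · intro h
    refine (hasArchType_iff_infinityType_eq χ _).mp ((hasArchType_iff χ _).mpr fun t => ?_)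
    have ht := apply_archToQuot χ' t
    rw [← h t] at ht
    exact ht

/-- A character of `[U(W_j)]` whose infinity type is not `m` has `χ′_∞ ≠ archWeight m` (the one-factor form of the
"other isotypic parts" remark of ll. 428–429). -/
theorem comp_archToQuot_ne_archWeight_of_infinityType_ne (χ : PontryaginDual (relNormOneIdeles L⁺ L ⧸ relNormOneRat L⁺ L))
    {m : InfinitePlace L → ℤ} (h : infinityType χ ≠ m) :
    (toComplexChar χ).comp (unitaryLineArchToQuot L) ≠ archWeight L m :=
  fun h' => h ((hasArchType_iff_infinityType_eq χ m).mp h')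

/-! ### Indexing by the real places `b` of `L₀` -/

/-- **The infinity type indexed by the real places of `L₀ = L⁺`**: `e_b := (infinityType χ′)_{w_b}` for the place
`w_b` of `L` above `b`. -/
def infinityTypeReal (χ : PontryaginDual (relNormOneIdeles L⁺ L ⧸ relNormOneRat L⁺ L)) : InfinitePlace L⁺ → ℤ :=
  infinityType χ ∘ placeAbove L

/-- (Ported verbatim from the HodgeCMPerL package; no docstring in the source.) -/
theorem infinityTypeReal_apply (χ : PontryaginDual (relNormOneIdeles L⁺ L ⧸ relNormOneRat L⁺ L)) (b : InfinitePlace L⁺) :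
    infinityTypeReal χ b = infinityType χ (placeAbove L b) := rfl

/-- (Ported verbatim from the HodgeCMPerL package; no docstring in the source.) -/
theorem infinityTypeReal_comp_equivInfinitePlace (χ : PontryaginDual (relNormOneIdeles L⁺ L ⧸ relNormOneRat L⁺ L)) :
    infinityTypeReal χ ∘ IsCMField.equivInfinitePlace L = infinityType χ := by
  funext w
  change infinityType χ (placeAbove L (IsCMField.equivInfinitePlace L w)) = _
  rw [placeAbove_equivInfinitePlace]

/-- (Ported verbatim from the HodgeCMPerL package; no docstring in the source.) -/
theorem infinityType_comp_placeAbove (χ : PontryaginDual (relNormOneIdeles L⁺ L ⧸ relNormOneRat L⁺ L)) :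
    infinityType χ ∘ placeAbove L = infinityTypeReal χ := rfl

/-- **l. 481 / l. 529 literally: `χ′_b(u) = u ^ {e_b}` on the real-place circle at EVERY real place `b`, with
`e = infinityTypeReal χ′`** (node 5's `realPlaceCircleQuot L b : U(W_{j,b}) → [U(W_j)]`). -/
theorem apply_realPlaceCircleQuot (χ : PontryaginDual (relNormOneIdeles L⁺ L ⧸ relNormOneRat L⁺ L))
    (b : InfinitePlace L⁺) (u : Circle) : χ (realPlaceCircleQuot L b u) = u ^ (infinityTypeReal χ b) := by
  rw [realPlaceCircleQuot_eq_archToQuot, apply_archToQuot_archCoord]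
  rfl

/-- `ℂ`-valued form (the `LocMatches` equation of pv02's `ArchA`). -/
theorem coe_apply_realPlaceCircleQuot (χ : PontryaginDual (relNormOneIdeles L⁺ L ⧸ relNormOneRat L⁺ L))
    (b : InfinitePlace L⁺) (u : Circle) :
    ((χ (realPlaceCircleQuot L b u) : Circle) : ℂ) = (u : ℂ) ^ (infinityTypeReal χ b) := by
  rw [apply_realPlaceCircleQuot, Circle.coe_zpow]

/-- The real-place exponents of `χ′` are `e` iff `e = infinityTypeReal χ′`. -/
theorem forall_realPlaceCircleQuot_iff_infinityTypeReal_eq (χ : PontryaginDual (relNormOneIdeles L⁺ L ⧸ relNormOneRat L⁺ L))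
    (e : InfinitePlace L⁺ → ℤ) :
    (∀ (b : InfinitePlace L⁺) (u : Circle), χ (realPlaceCircleQuot L b u) = u ^ (e b)) ↔ infinityTypeReal χ = e := by
  rw [forall_realPlaceCircle_iff_hasArchType', hasArchType_iff_infinityType_eq, ← infinityTypeReal_comp_equivInfinitePlace]
  constructor
  · intro h
    funext b
    have hb := congrFun h (placeAbove L b)
    simpa only [Function.comp_apply, equivInfinitePlace_placeAbove] using hb
  · rintro rfl
    rfl

/-- Node 5's set of real-place exponent vectors of `χ′` is the singleton `{infinityTypeReal χ′}` (node 5 proved it is a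
subsingleton). -/
theorem realPlaceExponents_eq_singleton (χ : PontryaginDual (relNormOneIdeles L⁺ L ⧸ relNormOneRat L⁺ L)) :
    {e : InfinitePlace L⁺ → ℤ | ∀ (b : InfinitePlace L⁺) (u : Circle), χ (realPlaceCircleQuot L b u) = u ^ (e b)} =
      {infinityTypeReal χ} := by
  ext e
  rw [mem_setOf_eq, mem_singleton_iff, forall_realPlaceCircleQuot_iff_infinityTypeReal_eq, eq_comm]

/-- (Ported verbatim from the HodgeCMPerL package; no docstring in the source.) -/
theorem infinityTypeReal_surjective :
    Surjective (infinityTypeReal : PontryaginDual (relNormOneIdeles L⁺ L ⧸ relNormOneRat L⁺ L) → InfinitePlace L⁺ → ℤ) := by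
  intro e
  obtain ⟨χ, hχ⟩ := exists_char_forall_realPlaceCircle' (L := L) e
  exact ⟨χ, (forall_realPlaceCircleQuot_iff_infinityTypeReal_eq χ e).mp hχ⟩

end InfinityType

/-! ## §4  The dual of `[T]` is partitioned by type into the index sets `allowedChars L m₁ m₂` -/

section SeesawType

variable {L : Type} [Field L] [NumberField L] [IsCMField L]

local notation "L⁺" => maximalRealSubfield L

/-- **The type `(m₁, m₂)` of a character `ξ = (χ′₁, χ′₂)` of `[T] = [U(W₁)] × [U(W₂)]`**: the pair of infinity types of
its two components. -/
def seesawType (ξ : PontryaginDual (SeesawTorus L⁺ L ⧸ rat L⁺ L)) : (InfinitePlace L → ℤ) × (InfinitePlace L → ℤ) :=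
  (infinityType (charFst ξ), infinityType (charSnd ξ))

/-- (Ported verbatim from the HodgeCMPerL package; no docstring in the source.) -/
theorem seesawType_fst (ξ : PontryaginDual (SeesawTorus L⁺ L ⧸ rat L⁺ L)) : (seesawType ξ).1 = infinityType (charFst ξ) := rfl

/-- (Ported verbatim from the HodgeCMPerL package; no docstring in the source.) -/
theorem seesawType_snd (ξ : PontryaginDual (SeesawTorus L⁺ L ⧸ rat L⁺ L)) : (seesawType ξ).2 = infinityType (charSnd ξ) := rfl

/-- (Ported verbatim from the HodgeCMPerL package; no docstring in the source.) -/
@[simp] theorem seesawType_charPair (ξ₁ ξ₂ : PontryaginDual (relNormOneIdeles L⁺ L ⧸ relNormOneRat L⁺ L)) :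
    seesawType (charPair ξ₁ ξ₂) = (infinityType ξ₁, infinityType ξ₂) := by
  rw [seesawType, charFst_charPair, charSnd_charPair]

/-- **`ξ` lies in node 4's index set of type `(m₁, m₂)` iff its type is `(m₁, m₂)`.** -/
theorem mem_allowedChars_iff_seesawType_eq (ξ : PontryaginDual (SeesawTorus L⁺ L ⧸ rat L⁺ L))
    (m₁ m₂ : InfinitePlace L → ℤ) : ξ ∈ allowedChars L m₁ m₂ ↔ seesawType ξ = (m₁, m₂) := by
  rw [mem_allowedChars, hasArchType_iff_infinityType_eq, hasArchType_iff_infinityType_eq, seesawType, Prod.mk.injEq]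

/-- Every character of `[T]` lies in the index set of its own type. -/
theorem mem_allowedChars_seesawType (ξ : PontryaginDual (SeesawTorus L⁺ L ⧸ rat L⁺ L)) :
    ξ ∈ allowedChars L (seesawType ξ).1 (seesawType ξ).2 :=
  (mem_allowedChars_iff_seesawType_eq ξ _ _).mpr rfl

/-- The index set of type `(m₁, m₂)` is the fibre of the type map. -/
theorem allowedChars_eq_preimage_seesawType (m₁ m₂ : InfinitePlace L → ℤ) :
    allowedChars L m₁ m₂ = seesawType ⁻¹' {(m₁, m₂)} :=
  Set.ext fun ξ => mem_allowedChars_iff_seesawType_eq ξ m₁ m₂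

/-- **The index sets cover the dual of `[T]`**: every character has SOME type … -/
theorem iUnion_allowedChars :
    (⋃ p : (InfinitePlace L → ℤ) × (InfinitePlace L → ℤ), allowedChars L p.1 p.2) =
      (univ : Set (PontryaginDual (SeesawTorus L⁺ L ⧸ rat L⁺ L))) :=
  eq_univ_of_forall fun ξ => mem_iUnion.mpr ⟨seesawType ξ, mem_allowedChars_seesawType ξ⟩

/-- … and EXACTLY one (node 4 `disjoint_allowedChars` is the other half of the partition). -/
theorem existsUnique_mem_allowedChars (ξ : PontryaginDual (SeesawTorus L⁺ L ⧸ rat L⁺ L)) :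
    ∃! p : (InfinitePlace L → ℤ) × (InfinitePlace L → ℤ), ξ ∈ allowedChars L p.1 p.2 :=
  ⟨seesawType ξ, mem_allowedChars_seesawType ξ, fun p hp => ((mem_allowedChars_iff_seesawType_eq ξ p.1 p.2).mp hp).symm⟩

/-- **The typed `ξ_∞` of an ARBITRARY character of `[T]`** (the `χ_∞` of l. 428): `ξ ∘ cl = w(seesawType ξ)` as homomorphisms
`T(L₀ ⊗ ℝ) →* ℂ`. -/
theorem toComplexChar_comp_toQuot_eq_weight (ξ : PontryaginDual (SeesawTorus L⁺ L ⧸ rat L⁺ L)) :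
    (toComplexChar ξ).comp (SeesawArchTorus.toQuot L) = SeesawArchTorus.weight L (seesawType ξ).1 (seesawType ξ).2 :=
  (mem_allowedChars_iff _ _ ξ).mp (mem_allowedChars_seesawType ξ)

/-- `ξ_∞ = w(m₁, m₂)` iff the type of `ξ` is `(m₁, m₂)`. -/
theorem comp_toQuot_eq_weight_iff_seesawType_eq (ξ : PontryaginDual (SeesawTorus L⁺ L ⧸ rat L⁺ L))
    (m₁ m₂ : InfinitePlace L → ℤ) :
    (toComplexChar ξ).comp (SeesawArchTorus.toQuot L) = SeesawArchTorus.weight L m₁ m₂ ↔ seesawType ξ = (m₁, m₂) := by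
  rw [← mem_allowedChars_iff, mem_allowedChars_iff_seesawType_eq]

/-- **ll. 428–429 "(the other `T(L₀⊗ℝ)`-isotypic parts integrate to zero against `χ`)", character level**: a character
`ξ` of `[T]` whose type is NOT `(m₁, m₂)` has `ξ_∞ ≠ w(m₁, m₂)` — exactly the hypothesis `hc : c ≠ w` of pv06-g3's landed
orthogonality lemma `HodgeCM.PerL34.Annihilation.integral_conj_mul_char_ne` (with `hw := SeesawArchTorus.norm_weight`),
which then gives `∫_{T(L₀⊗ℝ)} conj (w t) · ξ(cl t) dt = 0` (not restated here to keep this leaf's imports torus-side). -/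
theorem comp_toQuot_ne_weight_of_seesawType_ne (ξ : PontryaginDual (SeesawTorus L⁺ L ⧸ rat L⁺ L))
    {m₁ m₂ : InfinitePlace L → ℤ} (h : seesawType ξ ≠ (m₁, m₂)) :
    (toComplexChar ξ).comp (SeesawArchTorus.toQuot L) ≠ SeesawArchTorus.weight L m₁ m₂ :=
  fun h' => h ((comp_toQuot_eq_weight_iff_seesawType_eq ξ m₁ m₂).mp h')

/-- Conversely a character of type `(m₁, m₂)` is never `ξ_∞`-orthogonal to `w(m₁, m₂)`: `ξ_∞ = w`. -/
theorem not_mem_allowedChars_iff_comp_toQuot_ne_weight (ξ : PontryaginDual (SeesawTorus L⁺ L ⧸ rat L⁺ L))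
    (m₁ m₂ : InfinitePlace L → ℤ) :
    ξ ∉ allowedChars L m₁ m₂ ↔ (toComplexChar ξ).comp (SeesawArchTorus.toQuot L) ≠ SeesawArchTorus.weight L m₁ m₂ := by
  rw [mem_allowedChars_iff]

/-- The type of `ξ` read off `ξ_∞` through §2: it is THE pair `(m₁, m₂)` with `ξ ∘ cl = w(m₁, m₂)`. -/
theorem seesawType_eq_iff (ξ : PontryaginDual (SeesawTorus L⁺ L ⧸ rat L⁺ L)) (p : (InfinitePlace L → ℤ) × (InfinitePlace L → ℤ)) :
    seesawType ξ = p ↔ (toComplexChar ξ).comp (SeesawArchTorus.toQuot L) = SeesawArchTorus.weight L p.1 p.2 := by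
  rw [comp_toQuot_eq_weight_iff_seesawType_eq]

/-- (Ported verbatim from the HodgeCMPerL package; no docstring in the source.) -/
@[simp] theorem seesawType_one : seesawType (1 : PontryaginDual (SeesawTorus L⁺ L ⧸ rat L⁺ L)) = (0, 0) :=
  (mem_allowedChars_iff_seesawType_eq _ _ _).mp one_mem_allowedChars_zero

/-- (Ported verbatim from the HodgeCMPerL package; no docstring in the source.) -/
theorem seesawType_mul (ξ η : PontryaginDual (SeesawTorus L⁺ L ⧸ rat L⁺ L)) :
    seesawType (ξ * η) = seesawType ξ + seesawType η :=
  (mem_allowedChars_iff_seesawType_eq _ _ _).mp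
    (mul_mem_allowedChars (mem_allowedChars_seesawType ξ) (mem_allowedChars_seesawType η))

/-- (Ported verbatim from the HodgeCMPerL package; no docstring in the source.) -/
theorem seesawType_inv (ξ : PontryaginDual (SeesawTorus L⁺ L ⧸ rat L⁺ L)) : seesawType ξ⁻¹ = -seesawType ξ :=
  (mem_allowedChars_iff_seesawType_eq _ _ _).mp (inv_mem_allowedChars (mem_allowedChars_seesawType ξ))

/-- **Lemma 4.2(a) for `[T]` as surjectivity of the type map** (node 4 `exists_char_hasArchType`). -/
theorem seesawType_surjective :
    Surjective (seesawType : PontryaginDual (SeesawTorus L⁺ L ⧸ rat L⁺ L) → (InfinitePlace L → ℤ) × (InfinitePlace L → ℤ)) := by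
  rintro ⟨m₁, m₂⟩
  obtain ⟨ξ, hξ⟩ := exists_char_hasArchType (L := L) m₁ m₂
  exact ⟨ξ, (mem_allowedChars_iff_seesawType_eq ξ m₁ m₂).mp hξ⟩

variable (L) in
/-- The type map of `[T]` as a group homomorphism. -/
def seesawTypeHom :
    PontryaginDual (SeesawTorus L⁺ L ⧸ rat L⁺ L) →* Multiplicative ((InfinitePlace L → ℤ) × (InfinitePlace L → ℤ)) where
  toFun ξ := Multiplicative.ofAdd (seesawType ξ)
  map_one' := by rw [seesawType_one]; rfl
  map_mul' ξ η := by rw [seesawType_mul]; rfl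

/-- (Ported verbatim from the HodgeCMPerL package; no docstring in the source.) -/
@[simp] theorem seesawTypeHom_apply (ξ : PontryaginDual (SeesawTorus L⁺ L ⧸ rat L⁺ L)) :
    seesawTypeHom L ξ = Multiplicative.ofAdd (seesawType ξ) := rfl

/-- On the real-place circles of the two factors a character `ξ` of `[T]` is `u ↦ u ^ (e¹_b)` resp. `u ↦ u ^ (e²_b)` with
`(e¹, e²)` the real-place-indexed type of `ξ` (node 5's reading of `allowedChars`, now unconditional). -/
theorem apply_inl_realPlaceCircle (ξ : PontryaginDual (SeesawTorus L⁺ L ⧸ rat L⁺ L)) (b : InfinitePlace L⁺) (u : Circle) :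
    ξ (QuotientGroup.mk (inl L⁺ L (realPlaceCircle L b u))) = u ^ (infinityTypeReal (charFst ξ) b) := by
  conv_lhs => rw [← charPair_charFst_charSnd ξ, charPair_mk_inl_realPlaceCircle]
  exact apply_realPlaceCircleQuot _ b u

/-- (Ported verbatim from the HodgeCMPerL package; no docstring in the source.) -/
theorem apply_inr_realPlaceCircle (ξ : PontryaginDual (SeesawTorus L⁺ L ⧸ rat L⁺ L)) (b : InfinitePlace L⁺) (u : Circle) :
    ξ (QuotientGroup.mk (inr L⁺ L (realPlaceCircle L b u))) = u ^ (infinityTypeReal (charSnd ξ) b) := by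
  conv_lhs => rw [← charPair_charFst_charSnd ξ, charPair_mk_inr_realPlaceCircle]
  exact apply_realPlaceCircleQuot _ b u

end SeesawType

end SeesawTorus

end NumberField

end
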